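import Summits.Schanuel.Schanuel.Theorems.RootDecomp1KHyper73

/-!
# RootDecomp1KHyper — lens 6, generation 17 «BILOG STAIRCASE CELL» (BilogStair.lean edition 7 637b15ab…, 5821 l; §R TransferI ⟸ ElimDataI) — continuation (RootDecomp1KHyper74): §R (iii) `norm_aeval_third_le`, `transferI_of_elimData : ElimDataI → TransferI` (PROVED reduction: TRANSFER I needs no measure of algebraic independence of (π, log α)) and `sb_three_zB_of_elimData : ElimDataI → SB 3 zB`

(lens-6 g17 `BilogStair.lean` EDITION 7, sha256 637b15ab…d5b9, 5821 l, own farm rc 0 · 0 warn · 0 sorry · axioms std; §A–§P = editions 2–6 (ported as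
`RootDecomp1KHyper53`–`71`), §R appended in edition 7 (NODE/EDITION7 L1820 / REQUEST L1821: statement diff 0 removed / 0 changed / 32 added; critic VERDICT L1827: CLEARED as EDITION 7 of record, `ElimDataI` NOT a costume and TRUE as typed, TransferI credit DEFERRED to its proof; PORT GO (three parts here because of the 398-line cap));
port by census-1 gen 16 in parts `RootDecomp1KHyper72`–`74` — 72 = §R the elimination datum `ElimDataI` (Prop def, UNDECIDED: a Bezout identity between the FIXED
`fI G₁ = G₁(x₁, X, u x₁ + v X)` and `gI P₂` over `B4 = ℤ[x₁, T, u, v]`), `fI_map_eval` / `gI_map_eval`, `evB_of_bezout`, `lenB`, killing the dummy variable (`toFin1`), the integer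
specialisation `specQ` with length/degree bounds, the conjugate transfer for a fixed `R ≠ 0` (`exists_transfer_of_ne_zero`); 73 = the generic π-clash `pi_clash_fin1` and the FAMILY
NORM CLASH `resT_family_clash`; 74 = `norm_aeval_third_le`, `transferI_of_elimData : ElimDataI → TransferI` (PROVED reduction) and `sb_three_zB_of_elimData : ElimDataI → SB 3 zB`.
PORT edits: `sum_fin4` / `one_le_plen` / `cast_div_eq` private (per-part copies); eleven one-line docstrings added; the source's two `set_option linter.unusedSimpArgs false in` lines
(on `fI_map_eval` / `gI_map_eval`) carried as-is; statements and proofs otherwise verbatim. No credit carried (the THEOREM-credit claim «TransferI ⟸ ElimDataI» is the critic's to rule);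
`--supports stmt-Schanuel-33363`; rung 0.)
-/

open Complex Polynomial IntermediateField Filter
open scoped BigOperators

namespace Summit.Schanuel.Schanuel.Theorems.RootDecomp1KHyper

namespace HyperCell

namespace LatCell

namespace Bilog

variable {n : ℕ}
open Summit.Schanuel.Schanuel.Theorems.RootDecomp1KRelLiouvilleCell (mvPolyMeasure_one_of_polyMeasure ycoeff
  mvaeval_cons_eq_sum mvlen_ycoeff_le natDegree_finSuccEquiv_le_totalDegree norm_mvaeval_le_mvlen_mul_pow)

open Summit.Schanuel.Schanuel.Theorems.RootDecomp1KGeneric (norm_mvAeval_sub_le norm_cexp_sub_cexp_le lenMv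
  lenMv_nonneg)

section CaseI

/-- `A_k / E_k = a_k` and `B_k / E_k = b_k` for `A = num a · den b`, `B = num b · den a`, `E = den a · den b`. -/
private theorem cast_div_eq (a b : ℚ) :
    ((((a.num * b.den : ℤ)) : ℂ)) / (((a.den * b.den : ℕ)) : ℂ) = (a : ℂ) ∧
      ((((b.num * a.den : ℤ)) : ℂ)) / (((a.den * b.den : ℕ)) : ℂ) = (b : ℂ) := by
  have ha : (a.den : ℂ) ≠ 0 := by exact_mod_cast a.den_ne_zero
  have hb : (b.den : ℂ) ≠ 0 := by exact_mod_cast b.den_ne_zero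
  constructor
  · push_cast
    rw [mul_div_mul_right _ _ hb, Rat.cast_def]
  · push_cast
    rw [mul_comm (a.den : ℂ), mul_div_mul_right _ _ ha, Rat.cast_def]

/-- The mixed integer length of `ℤ[x₁, x₂, x₃]`-points: Lipschitz bound of an integer polynomial near a zero,
third coordinate only (`G(x, y, z') − G(x, y, z)`, a corollary of `norm_mvAeval_sub_le`). -/
theorem norm_aeval_third_le (G : MvPolynomial (Fin 3) ℤ) {x y z z' : ℂ} {M : ℝ} (hM : 1 ≤ M)
    (hx : ‖x‖ ≤ M) (hy : ‖y‖ ≤ M) (hz : ‖z‖ ≤ M) (hz' : ‖z'‖ ≤ M) (h0 : MvPolynomial.aeval ![x, y, z] G = 0) :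
    ‖MvPolynomial.aeval ![x, y, z'] G‖ ≤
      ((lenMv G : ℤ) : ℝ) * ((G.totalDegree : ℝ) * M ^ (3 * G.totalDegree)) * ‖z' - z‖ := by
  have hEs : ∀ s ∈ G.support, ∀ i, s i ≤ G.totalDegree := fun s hs i =>
    (MvPolynomial.monomial_le_degreeOf i hs).trans (MvPolynomial.degreeOf_le_totalDegree G i)
  have hxs : ∀ i : Fin 3, ‖(![x, y, z'] : Fin 3 → ℂ) i‖ ≤ M := fun i => by
    match i with
    | 0 => exact hx
    | 1 => exact hy
    | 2 => exact hz'
  have hys : ∀ i : Fin 3, ‖(![x, y, z] : Fin 3 → ℂ) i‖ ≤ M := fun i => by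
    match i with
    | 0 => exact hx
    | 1 => exact hy
    | 2 => exact hz
  have h1 := norm_mvAeval_sub_le G hEs hM _ _ hxs hys
  rw [h0, sub_zero, Fin.sum_univ_three] at h1
  simp only [Matrix.cons_val_zero, Matrix.cons_val_one, Matrix.cons_val_two, Matrix.tail_cons,
    Matrix.head_cons, sub_self, norm_zero, zero_add] at h1
  calc ‖MvPolynomial.aeval ![x, y, z'] G‖
      ≤ ((lenMv G : ℤ) : ℝ) * ((G.totalDegree : ℝ) * M ^ (3 * G.totalDegree) * ‖z' - z‖) := h1
    _ = _ := by ring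

/-- **TRANSFER I ⟸ THE ELIMINATION DATUM** (PROVED reduction; everything transcendence-theoretic is discharged:
the measure of `π` (`piMeasure_fin1`, tree), the conjugate data (`conjDataII_holds`, §P), the conjugate transfer
(`exists_transfer_of_ne_zero`, as §M); what remains, `ElimDataI`, is pure commutative algebra of FIXED
polynomials). -/
theorem transferI_of_elimData (hED : ElimDataI) : TransferI := by
  classical
  intro ℓ y a b halg hS hdeg hb hπℓ G₁ G₂ hG₁ hG₂ hG₁0 hG₂0
  obtain ⟨P₂, p, q, R, hP₂0, hR, hbez⟩ :=
    hED G₁ G₂ hG₁ hG₂ (Real.pi : ℂ) (ℓ : ℂ) (cexp ((y : ℂ) * I)) hπℓ hG₂0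
  obtain ⟨F, hF0, hFtr⟩ := exists_transfer_of_ne_zero hR
  refine ⟨F, hF0, ?_⟩
  obtain ⟨f, c, hf0, hfγ, hconj, hfdeg, hfcoef, hfroot⟩ := conjDataII_holds ℓ a b halg
  -- the sequences
  obtain ⟨A, hA⟩ : ∃ A : ℕ → ℤ, A = fun k => (a k).num * (b k).den := ⟨_, rfl⟩
  obtain ⟨B, hB⟩ : ∃ B : ℕ → ℤ, B = fun k => (b k).num * (a k).den := ⟨_, rfl⟩
  obtain ⟨E, hE⟩ : ∃ E : ℕ → ℕ, E = fun k => (a k).den * (b k).den := ⟨_, rfl⟩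
  obtain ⟨Q, hQ⟩ : ∃ Q : ℕ → MvPolynomial (Fin 3) ℤ, Q = fun k => specQ R (A k) (B k) (E k) := ⟨_, rfl⟩
  obtain ⟨D, hD⟩ : ∃ D : ℕ, D = R.totalDegree := ⟨_, rfl⟩
  obtain ⟨r, hr⟩ : ∃ r : ℕ → ℝ, r = fun k => (a k : ℝ) * Real.pi + (b k : ℝ) * ℓ := ⟨_, rfl⟩
  have hrC : ∀ k, ((r k : ℝ) : ℂ) = (a k : ℂ) * Real.pi + (b k : ℂ) * ℓ := fun k => by
    rw [hr]; push_cast; rfl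
  have hgam : ∀ k, gam ℓ a b k = cexp ((r k : ℂ) * I) := fun k => by rw [hr]; rfl
  have hgam1 : ∀ k, ‖gam ℓ a b k‖ = 1 := fun k => by rw [hgam k, Complex.norm_exp_ofReal_mul_I]
  have hH3 : ∀ k, (3 : ℝ) ≤ hgt a b k := three_le_hgt a b
  have hEk0 : ∀ k, E k ≠ 0 := fun k => by rw [hE]; exact Nat.mul_ne_zero (a k).den_ne_zero (b k).den_ne_zero
  have hvec : ∀ k (θ : ℂ), (![(Real.pi : ℂ), θ, ((A k : ℤ) : ℂ) / ((E k : ℕ) : ℂ), ((B k : ℤ) : ℂ) / ((E k : ℕ) : ℂ)] :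
      Fin 4 → ℂ) = ![(Real.pi : ℂ), θ, ((a k : ℚ) : ℂ), ((b k : ℚ) : ℂ)] := by
    intro k θ
    rw [hA, hB, hE]; dsimp only
    rw [(cast_div_eq (a k) (b k)).1, (cast_div_eq (a k) (b k)).2]
  have hQev : ∀ k (θ : ℂ), MvPolynomial.aeval ![(Real.pi : ℂ), 0, θ] (Q k) =
      ((E k : ℕ) : ℂ) ^ D * evB (Real.pi : ℂ) θ (a k) (b k) R := by
    intro k θ
    rw [hQ]; dsimp only
    rw [aeval_specQ R (A k) (B k) (hEk0 k), hvec, ← hD]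
    rfl
  -- `Q`-facts: degree and length
  have hQdeg : ∀ k, (Q k).totalDegree ≤ D := fun k => by rw [hQ, hD]; exact totalDegree_specQ_le _ _ _ _
  have hmR0 : (0 : ℝ) ≤ ((mvlen R : ℤ) : ℝ) := by exact_mod_cast mvlen_nonneg R
  have hEAB : ∀ k, ((E k : ℕ) : ℝ) + |(A k : ℝ)| + |(B k : ℝ)| ≤ 3 * hgt a b k ^ 2 := fun k => by
    have h1 := den_mul_den_le_hgt_sq a b k
    have h2 := num_mul_den_le_hgt_sq a b k
    rw [hE, hA, hB]; dsimp only
    push_cast at h1 h2 ⊢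
    linarith [h2.1, h2.2]
  have hEAB0 : ∀ k, (0 : ℝ) ≤ ((E k : ℕ) : ℝ) + |(A k : ℝ)| + |(B k : ℝ)| := fun k => by positivity
  have hQlen0 : ∀ k, ((mvlen (Q k) : ℤ) : ℝ) ≤ ((mvlen R : ℤ) : ℝ) * (3 * hgt a b k ^ 2) ^ D := fun k => by
    have hM := mvlen_specQ_le R (A k) (B k) (E k) (M := (E k : ℤ) + |A k| + |B k|)
      (by linarith [abs_nonneg (B k), Int.natCast_nonneg (E k)])
      (by linarith [abs_nonneg (A k), Int.natCast_nonneg (E k)])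
      (by linarith [abs_nonneg (A k), abs_nonneg (B k)])
    rw [← hD] at hM
    have hM' : ((mvlen (specQ R (A k) (B k) (E k)) : ℤ) : ℝ) ≤
        ((mvlen R : ℤ) : ℝ) * (((E k : ℕ) : ℝ) + |(A k : ℝ)| + |(B k : ℝ)|) ^ D := by
      have h' : ((mvlen (specQ R (A k) (B k) (E k)) : ℤ) : ℝ) ≤
          (((mvlen R * ((E k : ℤ) + |A k| + |B k|) ^ D : ℤ)) : ℝ) := by exact_mod_cast hM
      push_cast at h' ⊢
      exact h'
    rw [hQ]; dsimp only
    exact hM'.trans (mul_le_mul_of_nonneg_left (pow_le_pow_left₀ (hEAB0 k) (hEAB k) D) hmR0)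
  have pbQlen : PB a b fun k => ((mvlen (Q k) : ℤ) : ℝ) := by
    refine pb_of_le (pb_mul (pb_const _) (pb_mul (pb_const ((3 : ℝ) ^ D)) (pb_pow_hgt (2 * D))
      (Filter.Eventually.of_forall fun _ => by positivity)
      (Filter.Eventually.of_forall fun k => pow_nonneg (by linarith [hH3 k]) _))
      (Filter.Eventually.of_forall fun _ => hmR0)
      (Filter.Eventually.of_forall fun k => mul_nonneg (by positivity) (pow_nonneg (by linarith [hH3 k]) _)))
      (Filter.Eventually.of_forall fun k => ?_)
    have h := hQlen0 k
    rw [mul_pow, ← pow_mul] at h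
    exact h
  obtain ⟨cQ, hcQ⟩ := pbQlen
  have hQlen : ∀ᶠ k in atTop, ((mvlen (Q k) : ℤ) : ℝ) ≤ Real.exp (hgt a b k ^ cQ) :=
    hcQ.mono fun k hk => hk.trans (by linarith [Real.add_one_le_exp (hgt a b k ^ cQ)])
  -- the hyper-small sequence `|y − r_k|`
  have hclose : ∀ᶠ k in atTop, |y - r k| < 1 := (hS 0).mono fun k hk => by
    rw [hr]; dsimp only
    refine hk.trans_le ?_
    rw [pow_zero]
    exact (Real.exp_lt_one_iff.mpr (by norm_num)).le
  have hδsmall : ∀ m : ℕ, ∀ᶠ k in atTop, |y - r k| < Real.exp (-(hgt a b k) ^ m) := fun m =>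
    (hS m).mono fun k hk => by rw [hr]; exact hk
  have hδ0 : ∀ᶠ k in atTop, 0 ≤ |y - r k| := Filter.Eventually.of_forall fun _ => abs_nonneg _
  -- Lipschitz constants
  obtain ⟨R₀, hR₀⟩ : ∃ R₀ : ℝ, R₀ = |y| + Real.pi + |ℓ| + 2 := ⟨_, rfl⟩
  have hR₀1 : 1 ≤ R₀ := by rw [hR₀]; linarith [abs_nonneg y, abs_nonneg ℓ, Real.pi_pos]
  obtain ⟨L₁, hL₁⟩ : ∃ L₁ : ℝ,
      L₁ = ((lenMv G₁ : ℤ) : ℝ) * ((G₁.totalDegree : ℝ) * R₀ ^ (3 * G₁.totalDegree)) := ⟨_, rfl⟩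
  obtain ⟨L₂, hL₂⟩ : ∃ L₂ : ℝ,
      L₂ = ((lenMv P₂ : ℤ) : ℝ) * ((P₂.totalDegree : ℝ) * R₀ ^ (3 * P₂.totalDegree)) * 2 := ⟨_, rfl⟩
  have hL₁0 : 0 ≤ L₁ := by
    rw [hL₁]; have : (0 : ℝ) ≤ ((lenMv G₁ : ℤ) : ℝ) := by exact_mod_cast lenMv_nonneg G₁
    positivity
  have hL₂0 : 0 ≤ L₂ := by
    rw [hL₂]; have : (0 : ℝ) ≤ ((lenMv P₂ : ℤ) : ℝ) := by exact_mod_cast lenMv_nonneg P₂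
    positivity
  have hπR : ‖(Real.pi : ℂ)‖ ≤ R₀ := by
    rw [Complex.norm_real, Real.norm_eq_abs, abs_of_pos Real.pi_pos, hR₀]
    linarith [abs_nonneg y, abs_nonneg ℓ]
  have hℓR : ‖(ℓ : ℂ)‖ ≤ R₀ := by
    rw [Complex.norm_real, Real.norm_eq_abs, hR₀]; linarith [abs_nonneg y, Real.pi_pos]
  have hyR : ‖(y : ℂ)‖ ≤ R₀ := by
    rw [Complex.norm_real, Real.norm_eq_abs, hR₀]; linarith [abs_nonneg ℓ, Real.pi_pos]
  have hG₁small : ∀ᶠ k in atTop,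
      ‖MvPolynomial.aeval ![(Real.pi : ℂ), (ℓ : ℂ), (a k : ℂ) * Real.pi + (b k : ℂ) * ℓ] G₁‖ ≤ L₁ * |y - r k| :=
    hclose.mono fun k hk => by
      have hrR : ‖((r k : ℝ) : ℂ)‖ ≤ R₀ := by
        rw [Complex.norm_real, Real.norm_eq_abs, hR₀]
        have := abs_sub_abs_le_abs_sub (r k) y
        rw [abs_sub_comm] at hk
        linarith [abs_nonneg ℓ, Real.pi_pos]
      have h := norm_aeval_third_le G₁ hR₀1 hπR hℓR hyR hrR hG₁0
      have h2 : ‖((r k : ℝ) : ℂ) - (y : ℂ)‖ = |y - r k| := by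
        rw [show ((r k : ℝ) : ℂ) - (y : ℂ) = (((r k - y : ℝ)) : ℂ) by push_cast; ring, Complex.norm_real,
          Real.norm_eq_abs, abs_sub_comm]
      rw [← hrC k, hL₁, ← h2]
      exact h
  have hP₂small : ∀ᶠ k in atTop,
      ‖MvPolynomial.aeval ![(Real.pi : ℂ), (ℓ : ℂ), gam ℓ a b k] P₂‖ ≤ L₂ * |y - r k| :=
    hclose.mono fun k hk => by
      have hz : ‖cexp ((y : ℂ) * I)‖ ≤ R₀ := by rw [Complex.norm_exp_ofReal_mul_I]; exact hR₀1
      have hz' : ‖gam ℓ a b k‖ ≤ R₀ := by rw [hgam1]; exact hR₀1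
      have h := norm_aeval_third_le P₂ hR₀1 hπR hℓR hz hz' hP₂0
      have h2 : ‖((r k : ℝ) : ℂ) - (y : ℂ)‖ = |y - r k| := by
        rw [show ((r k : ℝ) : ℂ) - (y : ℂ) = (((r k - y : ℝ)) : ℂ) by push_cast; ring, Complex.norm_real,
          Real.norm_eq_abs, abs_sub_comm]
      have h3 : ‖gam ℓ a b k - cexp ((y : ℂ) * I)‖ ≤ 2 * |y - r k| := by
        rw [hgam k]
        have hd : ‖(r k : ℂ) * I - (y : ℂ) * I‖ = |y - r k| := by
          rw [← sub_mul, norm_mul, Complex.norm_I, mul_one, h2]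
        have := norm_cexp_sub_cexp_le (a := (r k : ℂ) * I) (b := (y : ℂ) * I) (by rw [hd]; exact hk.le)
        rwa [Complex.norm_exp_ofReal_mul_I, one_mul, hd] at this
      have hc0 : (0 : ℝ) ≤ ((lenMv P₂ : ℤ) : ℝ) * ((P₂.totalDegree : ℝ) * R₀ ^ (3 * P₂.totalDegree)) := by
        have : (0 : ℝ) ≤ ((lenMv P₂ : ℤ) : ℝ) := by exact_mod_cast lenMv_nonneg P₂
        positivity
      calc ‖MvPolynomial.aeval ![(Real.pi : ℂ), (ℓ : ℂ), gam ℓ a b k] P₂‖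
          ≤ ((lenMv P₂ : ℤ) : ℝ) * ((P₂.totalDegree : ℝ) * R₀ ^ (3 * P₂.totalDegree)) *
              ‖gam ℓ a b k - cexp ((y : ℂ) * I)‖ := h
        _ ≤ ((lenMv P₂ : ℤ) : ℝ) * ((P₂.totalDegree : ℝ) * R₀ ^ (3 * P₂.totalDegree)) * (2 * |y - r k|) :=
            mul_le_mul_of_nonneg_left h3 hc0
        _ = L₂ * |y - r k| := by rw [hL₂]; ring
  -- the polydisc radius for the cofactors `p, q`
  obtain ⟨Mk, hMk⟩ : ∃ Mk : ℕ → ℝ, Mk = fun k => R₀ * hgt a b k := ⟨_, rfl⟩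
  have hMk1 : ∀ k, 1 ≤ Mk k := fun k => by rw [hMk]; dsimp only; nlinarith [hH3 k]
  have hMkR : ∀ k, R₀ ≤ Mk k := fun k => by rw [hMk]; dsimp only; nlinarith [hH3 k]
  have hMkH : ∀ k, hgt a b k ≤ Mk k := fun k => by rw [hMk]; dsimp only; nlinarith [hH3 k]
  have haM : ∀ k, ‖((a k : ℚ) : ℂ)‖ ≤ Mk k ∧ ‖((b k : ℚ) : ℂ)‖ ≤ Mk k := fun k => by
    have h := abs_cast_le_hgt a b k
    rw [← Complex.ofReal_ratCast, Complex.norm_real, Real.norm_eq_abs, ← Complex.ofReal_ratCast,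
      Complex.norm_real, Real.norm_eq_abs]
    exact ⟨h.1.trans (hMkH k), h.2.trans (hMkH k)⟩
  -- the exponent
  obtain ⟨T, hT⟩ : ∃ T : ℕ → ℝ, T = fun k => (hgt a b k ^ 2) ^ D *
      (L₁ * ((lenB p : ℤ) : ℝ) * Mk k ^ degB p + L₂ * ((lenB q : ℤ) : ℝ) * Mk k ^ degB q) := ⟨_, rfl⟩
  have hlp0 : (0 : ℝ) ≤ ((lenB p : ℤ) : ℝ) := by exact_mod_cast lenB_nonneg p
  have hlq0 : (0 : ℝ) ≤ ((lenB q : ℤ) : ℝ) := by exact_mod_cast lenB_nonneg q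
  have hMk0 : ∀ k, 0 ≤ Mk k := fun k => by linarith [hMk1 k]
  have hT0 : ∀ k, 0 ≤ T k := fun k => by
    rw [hT]; dsimp only
    have := hMk0 k; have := hH3 k
    positivity
  have pbMk : PB a b Mk := by
    rw [hMk]; exact pb_mul (pb_const R₀) pb_hgt (Filter.Eventually.of_forall fun _ => by linarith)
      (Filter.Eventually.of_forall fun k => by linarith [hH3 k])
  have pbMkpow : ∀ n : ℕ, PB a b fun k => Mk k ^ n := fun n => by
    obtain ⟨c₀, hc₀⟩ := pbMk
    refine ⟨c₀ * n, hc₀.mono fun k hk => ?_⟩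
    rw [pow_mul]; exact pow_le_pow_left₀ (hMk0 k) hk n
  have pbT : PB a b T := by
    rw [hT]
    refine pb_mul ?_ (pb_add (pb_mul (pb_const _) (pbMkpow (degB p))
      (Filter.Eventually.of_forall fun _ => mul_nonneg hL₁0 hlp0) (Filter.Eventually.of_forall fun k =>
        pow_nonneg (hMk0 k) _)) (pb_mul (pb_const _) (pbMkpow (degB q))
      (Filter.Eventually.of_forall fun _ => mul_nonneg hL₂0 hlq0) (Filter.Eventually.of_forall fun k =>
        pow_nonneg (hMk0 k) _)))
      (Filter.Eventually.of_forall fun k => pow_nonneg (pow_nonneg (by linarith [hH3 k]) _) _)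
      (Filter.Eventually.of_forall fun k => add_nonneg (mul_nonneg (mul_nonneg hL₁0 hlp0) (pow_nonneg (hMk0 k) _))
        (mul_nonneg (mul_nonneg hL₂0 hlq0) (pow_nonneg (hMk0 k) _)))
    · refine ⟨2 * D, Filter.Eventually.of_forall fun k => ?_⟩
      show (hgt a b k ^ 2) ^ D ≤ _
      rw [← pow_mul]
  -- the value bound
  have hQval : ∀ᶠ k in atTop,
      ‖MvPolynomial.aeval ![(Real.pi : ℂ), 0, gam ℓ a b k] (Q k)‖ ≤ Real.exp (T k) * |y - r k| := by
    filter_upwards [hG₁small, hP₂small] with k h1 h2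
    rw [hQev k, evB_of_bezout hbez (Real.pi : ℂ) (gam ℓ a b k) (a k) (b k) (ℓ : ℂ), fI_map_eval, gI_map_eval,
      norm_mul, norm_pow, Complex.norm_natCast]
    have hp := norm_eval_map_evB_le p (hMk1 k) (hπR.trans (hMkR k)) ((hgam1 k).le.trans (hMk1 k)) (haM k).1
      (haM k).2 (hℓR.trans (hMkR k))
    have hq := norm_eval_map_evB_le q (hMk1 k) (hπR.trans (hMkR k)) ((hgam1 k).le.trans (hMk1 k)) (haM k).1
      (haM k).2 (hℓR.trans (hMkR k))
    have hEk : ((E k : ℕ) : ℝ) ≤ hgt a b k ^ 2 := by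
      have := den_mul_den_le_hgt_sq a b k; rw [hE]; exact this
    have hEpow : ((E k : ℕ) : ℝ) ^ D ≤ (hgt a b k ^ 2) ^ D := pow_le_pow_left₀ (Nat.cast_nonneg _) hEk D
    have hsum : ‖MvPolynomial.aeval ![(Real.pi : ℂ), (ℓ : ℂ), (a k : ℂ) * Real.pi + (b k : ℂ) * ℓ] G₁ *
          Polynomial.eval (ℓ : ℂ) (p.map (evB (Real.pi : ℂ) (gam ℓ a b k) (a k) (b k))) +
        MvPolynomial.aeval ![(Real.pi : ℂ), (ℓ : ℂ), gam ℓ a b k] P₂ *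
          Polynomial.eval (ℓ : ℂ) (q.map (evB (Real.pi : ℂ) (gam ℓ a b k) (a k) (b k)))‖ ≤
        (L₁ * ((lenB p : ℤ) : ℝ) * Mk k ^ degB p + L₂ * ((lenB q : ℤ) : ℝ) * Mk k ^ degB q) * |y - r k| := by
      refine (norm_add_le _ _).trans ?_
      rw [norm_mul, norm_mul]
      have e1 := mul_le_mul h1 hp (norm_nonneg _) (mul_nonneg hL₁0 (abs_nonneg _))
      have e2 := mul_le_mul h2 hq (norm_nonneg _) (mul_nonneg hL₂0 (abs_nonneg _))
      nlinarith [e1, e2]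
    have hT' : T k ≤ Real.exp (T k) := by linarith [Real.add_one_le_exp (T k)]
    have hS0 : 0 ≤ L₁ * ((lenB p : ℤ) : ℝ) * Mk k ^ degB p + L₂ * ((lenB q : ℤ) : ℝ) * Mk k ^ degB q :=
      add_nonneg (mul_nonneg (mul_nonneg hL₁0 hlp0) (pow_nonneg (hMk0 k) _))
        (mul_nonneg (mul_nonneg hL₂0 hlq0) (pow_nonneg (hMk0 k) _))
    calc ((E k : ℕ) : ℝ) ^ D * ‖MvPolynomial.aeval ![(Real.pi : ℂ), (ℓ : ℂ), (a k : ℂ) * Real.pi + (b k : ℂ) * ℓ] G₁ *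
            Polynomial.eval (ℓ : ℂ) (p.map (evB (Real.pi : ℂ) (gam ℓ a b k) (a k) (b k))) +
          MvPolynomial.aeval ![(Real.pi : ℂ), (ℓ : ℂ), gam ℓ a b k] P₂ *
            Polynomial.eval (ℓ : ℂ) (q.map (evB (Real.pi : ℂ) (gam ℓ a b k) (a k) (b k)))‖
        ≤ (hgt a b k ^ 2) ^ D *
            ((L₁ * ((lenB p : ℤ) : ℝ) * Mk k ^ degB p + L₂ * ((lenB q : ℤ) : ℝ) * Mk k ^ degB q) * |y - r k|) :=
          mul_le_mul hEpow hsum (norm_nonneg _) (pow_nonneg (pow_nonneg (by linarith [hH3 k]) _) _)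
      _ = T k * |y - r k| := by rw [hT]; dsimp only; ring
      _ ≤ Real.exp (T k) * |y - r k| := mul_le_mul_of_nonneg_right hT' (abs_nonneg _)
  -- the norm clash: a conjugate slice vanishes
  have hclash := resT_family_clash (a := a) (b := b) hf0 hfγ hfdeg hfcoef hfroot Q hQdeg hQlen hδ0 hδsmall
    pbT hQval
  filter_upwards [hclash] with k hk
  obtain ⟨z, hz, hQz⟩ := hk
  have hev : evB (Real.pi : ℂ) z (a k) (b k) R = 0 := by
    have h := hQz
    rw [hQev k z] at h
    exact (mul_eq_zero.mp h).resolve_left (pow_ne_zero _ (by exact_mod_cast hEk0 k))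
  exact hFtr (a k) (b k) (gam ℓ a b k) z (isIntegral_gam_of_algebraic halg k) (hconj k z hz) hev

/-- **Consequently `SB 3 zB ⟸ ElimDataI`** — the member's degree-3 Schanuel bound now rests on ONE statement of
pure commutative algebra about fixed integer polynomials (Case II is PROVED, `transferII_holds`). -/
theorem sb_three_zB_of_elimData (hED : ElimDataI) : SB 3 zB :=
  sb_three_zB_of (transferI_of_elimData hED) transferII_holds

end CaseI

end Bilog
end LatCell
end HyperCell
end Summit.Schanuel.Schanuel.Theorems.RootDecomp1KHyper
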